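import Summits.QuantumFields.BalabanUV.Beta.EriceRemainderEnclosureHistoryAutonomyComparisonMarkovCredit

/-!
# EriceRemainderEnclosureHistoryAutonomyComparisonMarkovGradingLinks — (E139c) **BRICKS OF THE MARKOV GRADING: an a-priori LEVEL LADDER for every orbit from a MARKOV
# MINORANT of the memory (`level_ge_ladder`: if `B u ≥ G(1∕u_0²)` on the box and `ψ(a)` lies below every `x` with `a + G(x) ≤ x`, then every box solution of every
# `B″ ≥ B` from a pin of level `A` has its scale-`j` level `≥ ψ^[j](A)`), the flow links and the sandwich of (E138b) with the profile read on the LADDER-GRADED box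
# (`flow_link_lower_gr`, `flow_link_upper_gr`, `dual_steps_sandwich_gr`), and the deep rows (`deep_steps_nonneg_gr`).**  The comparison theorem with Markov grading
# and Markov credit is (E139d) `…ComparisonMarkovGrading`.

WHY (g106 `README.md` §4 (α‴-1): «orbit-graded contraction — the statement needs an a-priori level growth for all box solutions of `B` AND for `h′`»).  The floor
gives the growth `A + (k+1)·b` used by (E138)∕(E139a∕b); a memory with a large MARKOV part `G(1∕u_0²)` (steep in the CURRENT coupling) drives every orbit — of `B` and of
any `B′ ≥ B` — up the ladder `ψ^[j](A)`, `ψ(a)` the root of `x = a + G(x)`, which can be far above `A + j·b`; history slopes are then read where they have decayed.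
Numerically (g107 `kit/markovcheck107.py`) this SPEED effect, not the credit, is what makes `β₀ + L₀∕a_0 + L_J·a_J^{−r}` compare at `L_J = 10⁵`: the effective age
moment at the top row drops from `3.4` (`L₀ = 0`) to `0.10` (`L₀ = 30`) and `0.00` (`L₀ = 300`).

Cell `pub-balaban`, β-function sub-cell, BINDER row D4 «RemainderConst leaves for Bałaban's split» (`HOME/BINDER-OWNERS.md`; owner lineage `b2b-balaban-beta-an4`;
this file by co-owner #2 lineage `b2b-balaban-beta-d4-p2`, generation 107), β-FLOW TEAM duty (1), FREEZE (0) honoured (def-free; (E138a) `sandwich_of_links` ∕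
`dual_step_eq_levels` ∕ `gap_le_sum_parts`, (E138b) `flow_violation_bound` ∕ `flow_source_le`, (E139a) `exists_deep_row`, (E49j) `seqBox_mono` ∕ `seqBox_of_le_pin`, (E48a)
`le_pin_of_memFlow` ∕ `memFlow_tail` ∕ `strictAnti_of_memFlow` BY NAME; the ladder-graded links re-prove (E138b) §3 with `tail_graded` replaced by `level_ge_ladder`,
nothing else restated).

HONEST FRAMING (page 1, verbatim and binding).  *"Discharging BetaPertH makes Bałaban's UV stability UNCONDITIONAL — a real constructive-QFT result; it is
NOT the continuum limit and NOT the Clay problem."*  THIS FILE DISCHARGES NOTHING OF THE KIND.  Elementary real analysis about ABSTRACT functionals on a box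
]0,γ]^ℕ (node U2's `MemFlow` ∕ `SeqBox`) — hypotheses of a census, not facts; nothing about Bałaban's (1.22) limit functional is PRINTED in this form ([I] p. 298;
GAPS G-t4-U2-1∕-2) or asserted.  Row D4 class UNCHANGED (critical-path width 0; instance 0∕1; D4 DISCHARGE NO DATE).  NOT B12 Thm 2, NOT BetaPertH, NOT
continuum YM, NOT Clay.

WHAT IS PROVED ([folklore]; 0 `def`, 0 sorry).  §1 `iterate_mono`, **`level_ge_ladder`**.  §2 **`flow_link_lower_gr`**, **`flow_link_upper_gr`**, **`dual_steps_sandwich_gr`**.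
§3 **`deep_steps_nonneg_gr`**.
-/

noncomputable section
open Finset Set

namespace Summit.QuantumFields.BalabanUV.Beta.EriceRemainderEnclosureHistoryAutonomyComparisonMarkovGradingLinks

open Literature.MathematicalPhysics.QuantumFieldTheory.Balaban1983to89
open Literature.MathematicalPhysics.QuantumFieldTheory.Balaban1983to89.T4BetaStationary
open Literature.MathematicalPhysics.QuantumFieldTheory.Balaban1983to89.T4BetaFlowWellPosed
open Summit.QuantumFields.BalabanUV.Beta.EriceRemainderEnclosureHistoryAutonomyOrder
  (le_pin_of_memFlow memFlow_tail strictAnti_of_memFlow)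
open Summit.QuantumFields.BalabanUV.Beta.EriceRemainderEnclosureHistoryAutonomyComparisonExcess (seqBox_mono seqBox_of_le_pin)
open Summit.QuantumFields.BalabanUV.Beta.EriceRemainderEnclosureHistoryAutonomyComparisonDualContractionLinks
  (sandwich_of_links dual_step_eq_levels gap_le_sum_parts)
open Summit.QuantumFields.BalabanUV.Beta.EriceRemainderEnclosureHistoryAutonomyComparisonDualContraction (flow_violation_bound flow_source_le)
open Summit.QuantumFields.BalabanUV.Beta.EriceRemainderEnclosureHistoryAutonomyComparisonMarkovCreditLinks (exists_deep_row)

variable {B B' : (ℕ → ℝ) → ℝ} {M γ b βb : ℝ} {S : ℝ → ℕ → ℝ} {h h' : ℕ → ℝ} {G ψ : ℝ → ℝ}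

/-! ## §1 The level ladder of a Markov minorant -/

/-- Iterates of a monotone real map are monotone. [folklore] -/
theorem iterate_mono (hψmono : Monotone ψ) (j : ℕ) : Monotone (ψ^[j]) :=
  hψmono.iterate j

/-- **THE LEVEL LADDER.**  `G` a MARKOV MINORANT of `B` on the box — `G(1∕u_0²) ≤ B u` — and `ψ` a monotone map lying below every supersolution of the Markov step:
`a + G(x) ≤ x ⟹ ψ(a) ≤ x` (e.g. `G ≡ b`, `ψ(a) = a + b`; `G(x) = b + L₀∕x`, `ψ(a) = (a + b + √((a+b)² + 4L₀))∕2`).  Then every box solution `k` of `B` from the pin `q`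
climbs the ladder: `ψ^[j](1∕q²) ≤ 1∕k_j²` — the step `1∕k_{j+1}² = 1∕k_j² + B(tail) ≥ 1∕k_j² + G(1∕k_{j+1}²)` is a supersolution from `1∕k_j²`. [folklore] -/
theorem level_ge_ladder (hG : ∀ u, SeqBox γ u → G (1 / u 0 ^ 2) ≤ B u) (hψ : ∀ a x : ℝ, a + G x ≤ x → ψ a ≤ x) (hψmono : Monotone ψ)
    (hk : SeqBox γ h) {q : ℝ} (hf : MemFlow B q h) : ∀ j : ℕ, ψ^[j] (1 / q ^ 2) ≤ 1 / h j ^ 2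
  | 0 => by simp [hf.1]
  | j + 1 => by
    have ih := level_ge_ladder hG hψ hψmono hk hf j
    rw [Function.iterate_succ_apply']
    refine (hψmono ih).trans (hψ _ _ ?_)
    have hstep : 1 / h (j + 1) ^ 2 = 1 / h j ^ 2 + B (fun i => h (j + 1 + i)) := hf.2 j
    have hGle := hG _ (seqBox_shift hk (j + 1))
    simp only [add_zero] at hGle
    linarith

/-! ## §2 The flow links and the sandwich with the ladder-graded profile -/

/-- **THE LOWER LINK, LADDER-GRADED.**  As (E138b) `flow_link_lower`, with the profile `Λ` valid on the LADDER-GRADED box above `1∕γ²` — configurations whose age-`k` level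
is `≥ ψ^[k+1](1∕γ²)` — where every tail of every box solution of `B` or of `B′ ≥ B` from a pin in `]0,γ]` lies (`level_ge_ladder`, `ψ` monotone). [folklore] -/
theorem flow_link_lower_gr {Λ : ℕ → ℝ} {K : ℕ} (hb : 0 < b)
    (hmono : ∀ u v : ℕ → ℝ, SeqBox γ u → SeqBox γ v → (∀ i, u i ≤ v i) → B u ≤ B v)
    (hB : ∀ u u' : ℕ → ℝ, SeqBox γ u → SeqBox γ u' → ∀ D : ℝ, (∀ j, |u j - u' j| ≤ D) → |B u - B u'| ≤ M * D) (hM : 0 ≤ M)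
    (hlo : ∀ u, SeqBox γ u → b ≤ B u)
    (hS : ∀ p, 0 < p → p ≤ γ → SeqBox γ (S p) ∧ MemFlow B p (S p))
    (huniq : ∀ p, 0 < p → p ≤ γ → ∀ u u' : ℕ → ℝ, SeqBox γ u → SeqBox γ u' → MemFlow B p u → MemFlow B p u' → u = u')
    (hG : ∀ u, SeqBox γ u → G (1 / u 0 ^ 2) ≤ B u) (hψ : ∀ a x : ℝ, a + G x ≤ x → ψ a ≤ x) (hψmono : Monotone ψ)
    (hΛ : ∀ k, 0 ≤ Λ k)
    (hLip : ∀ u v : ℕ → ℝ, SeqBox γ u → SeqBox γ v → (∀ k : ℕ, ψ^[k + 1] (1 / γ ^ 2) ≤ 1 / u k ^ 2) →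
      (∀ k : ℕ, ψ^[k + 1] (1 / γ ^ 2) ≤ 1 / v k ^ 2) → B u - B v ≤ ∑ k ∈ range K, Λ k * max (1 / v k ^ 2 - 1 / u k ^ 2) 0)
    (hexc : ∀ u, SeqBox γ u → B u ≤ B' u)
    (hh' : SeqBox γ h') {y : ℝ} (hf' : MemFlow B' y h') (n : ℕ) :
    (B' (fun i => h' (n + 1 + i)) - B (fun i => h' (n + 1 + i))) - (1 / h' (n + 1) ^ 2 - 1 / S (h' n) 1 ^ 2)
      ≤ ∑ k ∈ range K, Λ k * ∑ l ∈ range (k + 1), max (1 / h' (n + l + 1) ^ 2 - 1 / S (h' (n + l)) 1 ^ 2) 0 := by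
  have hpn := hh' n
  have hSn := hS (h' n) hpn.1 hpn.2
  have hu : SeqBox γ (fun i => S (h' n) (1 + i)) := fun i => hSn.1 (1 + i)
  have hv : SeqBox γ (fun i => h' (n + 1 + i)) := fun i => hh' (n + 1 + i)
  have hG' : ∀ u, SeqBox γ u → G (1 / u 0 ^ 2) ≤ B' u := fun u hu => (hG u hu).trans (hexc u hu)
  -- the pin level of row n is above the box top's, and the ladder is monotone
  have hAn : 1 / γ ^ 2 ≤ 1 / h' n ^ 2 := one_div_le_one_div_of_le (pow_pos hpn.1 2) (pow_le_pow_left₀ hpn.1.le hpn.2 2)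
  have hgu : ∀ k : ℕ, ψ^[k + 1] (1 / γ ^ 2) ≤ 1 / (fun i => S (h' n) (1 + i)) k ^ 2 := by
    intro k
    have := level_ge_ladder hG hψ hψmono hSn.1 hSn.2 (1 + k)
    rw [show 1 + k = k + 1 by omega] at this
    exact (iterate_mono hψmono (k + 1) hAn).trans (by simpa [Nat.add_comm] using this)
  have htailbox : SeqBox γ (fun i => h' (n + i)) := fun i => hh' (n + i)
  have htailflow : MemFlow B' (h' n) (fun i => h' (n + i)) := memFlow_tail hf' n
  have hgv : ∀ k : ℕ, ψ^[k + 1] (1 / γ ^ 2) ≤ 1 / (fun i => h' (n + 1 + i)) k ^ 2 := by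
    intro k
    have := level_ge_ladder hG' hψ hψmono htailbox htailflow (k + 1)
    refine (iterate_mono hψmono (k + 1) hAn).trans ?_
    simpa [show n + (k + 1) = n + 1 + k by omega] using this
  have hdrop := hLip _ _ hu hv hgu hgv
  beta_reduce at hdrop
  have heq := dual_step_eq_levels hS hh' hf' n
  have hsum : ∑ k ∈ range K, Λ k * max (1 / h' (n + 1 + k) ^ 2 - 1 / S (h' n) (1 + k) ^ 2) 0
      ≤ ∑ k ∈ range K, Λ k * ∑ l ∈ range (k + 1), max (1 / h' (n + l + 1) ^ 2 - 1 / S (h' (n + l)) 1 ^ 2) 0 :=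
    sum_le_sum fun k _ => mul_le_mul_of_nonneg_left
      (max_le (gap_le_sum_parts hb hmono hB hM hlo hS huniq hh' k n).1 (sum_nonneg fun l _ => le_max_right _ _)) (hΛ k)
  linarith [hdrop, heq, hsum]

/-- **THE UPPER LINK, LADDER-GRADED** (as (E138b) `flow_link_upper`). [folklore] -/
theorem flow_link_upper_gr {Λ : ℕ → ℝ} {K : ℕ} (hb : 0 < b)
    (hmono : ∀ u v : ℕ → ℝ, SeqBox γ u → SeqBox γ v → (∀ i, u i ≤ v i) → B u ≤ B v)
    (hB : ∀ u u' : ℕ → ℝ, SeqBox γ u → SeqBox γ u' → ∀ D : ℝ, (∀ j, |u j - u' j| ≤ D) → |B u - B u'| ≤ M * D) (hM : 0 ≤ M)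
    (hlo : ∀ u, SeqBox γ u → b ≤ B u)
    (hS : ∀ p, 0 < p → p ≤ γ → SeqBox γ (S p) ∧ MemFlow B p (S p))
    (huniq : ∀ p, 0 < p → p ≤ γ → ∀ u u' : ℕ → ℝ, SeqBox γ u → SeqBox γ u' → MemFlow B p u → MemFlow B p u' → u = u')
    (hG : ∀ u, SeqBox γ u → G (1 / u 0 ^ 2) ≤ B u) (hψ : ∀ a x : ℝ, a + G x ≤ x → ψ a ≤ x) (hψmono : Monotone ψ)
    (hΛ : ∀ k, 0 ≤ Λ k)
    (hLip : ∀ u v : ℕ → ℝ, SeqBox γ u → SeqBox γ v → (∀ k : ℕ, ψ^[k + 1] (1 / γ ^ 2) ≤ 1 / u k ^ 2) →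
      (∀ k : ℕ, ψ^[k + 1] (1 / γ ^ 2) ≤ 1 / v k ^ 2) → B u - B v ≤ ∑ k ∈ range K, Λ k * max (1 / v k ^ 2 - 1 / u k ^ 2) 0)
    (hexc : ∀ u, SeqBox γ u → B u ≤ B' u)
    (hh' : SeqBox γ h') {y : ℝ} (hf' : MemFlow B' y h') (n : ℕ) :
    (1 / h' (n + 1) ^ 2 - 1 / S (h' n) 1 ^ 2) - (B' (fun i => h' (n + 1 + i)) - B (fun i => h' (n + 1 + i)))
      ≤ ∑ k ∈ range K, Λ k * ∑ l ∈ range (k + 1), max (-(1 / h' (n + l + 1) ^ 2 - 1 / S (h' (n + l)) 1 ^ 2)) 0 := by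
  have hpn := hh' n
  have hSn := hS (h' n) hpn.1 hpn.2
  have hu : SeqBox γ (fun i => S (h' n) (1 + i)) := fun i => hSn.1 (1 + i)
  have hv : SeqBox γ (fun i => h' (n + 1 + i)) := fun i => hh' (n + 1 + i)
  have hG' : ∀ u, SeqBox γ u → G (1 / u 0 ^ 2) ≤ B' u := fun u hu => (hG u hu).trans (hexc u hu)
  have hAn : 1 / γ ^ 2 ≤ 1 / h' n ^ 2 := one_div_le_one_div_of_le (pow_pos hpn.1 2) (pow_le_pow_left₀ hpn.1.le hpn.2 2)
  have hgu : ∀ k : ℕ, ψ^[k + 1] (1 / γ ^ 2) ≤ 1 / (fun i => S (h' n) (1 + i)) k ^ 2 := by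
    intro k
    have := level_ge_ladder hG hψ hψmono hSn.1 hSn.2 (1 + k)
    rw [show 1 + k = k + 1 by omega] at this
    exact (iterate_mono hψmono (k + 1) hAn).trans (by simpa [Nat.add_comm] using this)
  have htailbox : SeqBox γ (fun i => h' (n + i)) := fun i => hh' (n + i)
  have htailflow : MemFlow B' (h' n) (fun i => h' (n + i)) := memFlow_tail hf' n
  have hgv : ∀ k : ℕ, ψ^[k + 1] (1 / γ ^ 2) ≤ 1 / (fun i => h' (n + 1 + i)) k ^ 2 := by
    intro k
    have := level_ge_ladder hG' hψ hψmono htailbox htailflow (k + 1)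
    refine (iterate_mono hψmono (k + 1) hAn).trans ?_
    simpa [show n + (k + 1) = n + 1 + k by omega] using this
  have hrise := hLip _ _ hv hu hgv hgu
  beta_reduce at hrise
  have heq := dual_step_eq_levels hS hh' hf' n
  have hsum : ∑ k ∈ range K, Λ k * max (1 / S (h' n) (1 + k) ^ 2 - 1 / h' (n + 1 + k) ^ 2) 0
      ≤ ∑ k ∈ range K, Λ k * ∑ l ∈ range (k + 1), max (-(1 / h' (n + l + 1) ^ 2 - 1 / S (h' (n + l)) 1 ^ 2)) 0 :=
    sum_le_sum fun k _ => mul_le_mul_of_nonneg_left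
      (max_le (by linarith [(gap_le_sum_parts hb hmono hB hM hlo hS huniq hh' k n).2])
        (sum_nonneg fun l _ => le_max_right _ _)) (hΛ k)
  linarith [hrise, heq, hsum]

/-- **THE DUAL STEPS ARE SANDWICHED, LADDER-GRADED** (as (E138b) `dual_steps_sandwich`): strict age moment `Σ_k k·Λ_k < 1` of a profile valid on the ladder-graded box
above `1∕γ²`, `B ≤ B′ ≤ β̄` with isotone excess ⟹ `0 ≤ X_n ≤ E_n` at every row of every box solution of `B′` from a pin in `]0,γ]`. [folklore] -/
theorem dual_steps_sandwich_gr {Λ : ℕ → ℝ} {K : ℕ} (hb : 0 < b)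
    (hmono : ∀ u v : ℕ → ℝ, SeqBox γ u → SeqBox γ v → (∀ i, u i ≤ v i) → B u ≤ B v)
    (hB : ∀ u u' : ℕ → ℝ, SeqBox γ u → SeqBox γ u' → ∀ D : ℝ, (∀ j, |u j - u' j| ≤ D) → |B u - B u'| ≤ M * D) (hM : 0 ≤ M)
    (hlo : ∀ u, SeqBox γ u → b ≤ B u)
    (hS : ∀ p, 0 < p → p ≤ γ → SeqBox γ (S p) ∧ MemFlow B p (S p))
    (huniq : ∀ p, 0 < p → p ≤ γ → ∀ u u' : ℕ → ℝ, SeqBox γ u → SeqBox γ u' → MemFlow B p u → MemFlow B p u' → u = u')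
    (hG : ∀ u, SeqBox γ u → G (1 / u 0 ^ 2) ≤ B u) (hψ : ∀ a x : ℝ, a + G x ≤ x → ψ a ≤ x) (hψmono : Monotone ψ)
    (hΛ : ∀ k, 0 ≤ Λ k) (hθ : ∑ k ∈ range K, (k : ℝ) * Λ k < 1)
    (hLip : ∀ u v : ℕ → ℝ, SeqBox γ u → SeqBox γ v → (∀ k : ℕ, ψ^[k + 1] (1 / γ ^ 2) ≤ 1 / u k ^ 2) →
      (∀ k : ℕ, ψ^[k + 1] (1 / γ ^ 2) ≤ 1 / v k ^ 2) → B u - B v ≤ ∑ k ∈ range K, Λ k * max (1 / v k ^ 2 - 1 / u k ^ 2) 0)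
    (hexc : ∀ u, SeqBox γ u → B u ≤ B' u) (hbdd : ∀ u, SeqBox γ u → B' u ≤ βb)
    (hDmono : ∀ u v : ℕ → ℝ, SeqBox γ u → SeqBox γ v → (∀ i, u i ≤ v i) → B' u - B u ≤ B' v - B v)
    (hh' : SeqBox γ h') {y : ℝ} (hf' : MemFlow B' y h') (n : ℕ) :
    0 ≤ 1 / h' (n + 1) ^ 2 - 1 / S (h' n) 1 ^ 2
      ∧ 1 / h' (n + 1) ^ 2 - 1 / S (h' n) 1 ^ 2 ≤ B' (fun i => h' (n + 1 + i)) - B (fun i => h' (n + 1 + i)) := by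
  have hlo' : ∀ u, SeqBox γ u → b ≤ B' u := fun u hu => (hlo u hu).trans (hexc u hu)
  exact sandwich_of_links (X := fun m => 1 / h' (m + 1) ^ 2 - 1 / S (h' m) 1 ^ 2)
    (E := fun m => B' (fun i => h' (m + 1 + i)) - B (fun i => h' (m + 1 + i))) hΛ hθ
    (fun m => sub_nonneg.mpr (hexc _ fun i => hh' (m + 1 + i)))
    (fun m l => flow_source_le hb hlo' hDmono hh' hf' m l)
    (fun m => flow_link_lower_gr hb hmono hB hM hlo hS huniq hG hψ hψmono hΛ hLip hexc hh' hf' m)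
    (fun m => flow_link_upper_gr hb hmono hB hM hlo hS huniq hG hψ hψmono hΛ hLip hexc hh' hf' m)
    (fun m => flow_violation_bound hb hlo hS hexc hbdd hh' hf' m) n

/-! ## §3 Deep rows with the ladder grading -/

/-- **THE DUAL STEPS ARE NON-NEGATIVE FROM A DEEP ROW ON, LADDER-GRADED** (as (E139a) `deep_steps_nonneg`): level-graded profile `Λ_k(A)` valid on the ladder-graded box
above `A` (age-`k` levels `≥ ψ^[k+1](A)`) for every `A`; at a row `N` with `Σ_k k·Λ_k(1∕h′_N²) < 1` the sandwich holds on the box `]0,h′_N]` from there on. [folklore] -/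
theorem deep_steps_nonneg_gr {Λ : ℕ → ℝ → ℝ} {K : ℕ} (hb : 0 < b)
    (hmono : ∀ u v : ℕ → ℝ, SeqBox γ u → SeqBox γ v → (∀ i, u i ≤ v i) → B u ≤ B v)
    (hB : ∀ u u' : ℕ → ℝ, SeqBox γ u → SeqBox γ u' → ∀ D : ℝ, (∀ j, |u j - u' j| ≤ D) → |B u - B u'| ≤ M * D) (hM : 0 ≤ M)
    (hlo : ∀ u, SeqBox γ u → b ≤ B u)
    (hS : ∀ p, 0 < p → p ≤ γ → SeqBox γ (S p) ∧ MemFlow B p (S p))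
    (huniq : ∀ p, 0 < p → p ≤ γ → ∀ u u' : ℕ → ℝ, SeqBox γ u → SeqBox γ u' → MemFlow B p u → MemFlow B p u' → u = u')
    (hG : ∀ u, SeqBox γ u → G (1 / u 0 ^ 2) ≤ B u) (hψ : ∀ a x : ℝ, a + G x ≤ x → ψ a ≤ x) (hψmono : Monotone ψ)
    (hΛ : ∀ k A, 0 ≤ Λ k A)
    (hLip : ∀ A : ℝ, ∀ u v : ℕ → ℝ, SeqBox γ u → SeqBox γ v → (∀ k : ℕ, ψ^[k + 1] A ≤ 1 / u k ^ 2) →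
      (∀ k : ℕ, ψ^[k + 1] A ≤ 1 / v k ^ 2) → B u - B v ≤ ∑ k ∈ range K, Λ k A * max (1 / v k ^ 2 - 1 / u k ^ 2) 0)
    (hexc : ∀ u, SeqBox γ u → B u ≤ B' u) (hbdd : ∀ u, SeqBox γ u → B' u ≤ βb)
    (hDmono : ∀ u v : ℕ → ℝ, SeqBox γ u → SeqBox γ v → (∀ i, u i ≤ v i) → B' u - B u ≤ B' v - B v)
    (hh' : SeqBox γ h') {y : ℝ} (hf' : MemFlow B' y h') (N : ℕ)
    (hθ : ∑ k ∈ range K, (k : ℝ) * Λ k (1 / h' N ^ 2) < 1) :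
    ∀ n, N ≤ n → 0 ≤ 1 / h' (n + 1) ^ 2 - 1 / S (h' n) 1 ^ 2 := by
  intro n hn
  obtain ⟨m, rfl⟩ := Nat.exists_eq_add_of_le hn
  have hlo' : ∀ u, SeqBox γ u → b ≤ B' u := fun u hu => (hlo u hu).trans (hexc u hu)
  have hanti : Antitone h' := (strictAnti_of_memFlow hb hlo' hh' hf').antitone
  have hγ'γ : h' N ≤ γ := (hh' N).2
  have hh'' : SeqBox (h' N) (fun i => h' (N + i)) := fun i => ⟨(hh' (N + i)).1, hanti (Nat.le_add_right N i)⟩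
  have hf'' : MemFlow B' (h' N) (fun i => h' (N + i)) := memFlow_tail hf' N
  have hS' : ∀ p, 0 < p → p ≤ h' N → SeqBox (h' N) (S p) ∧ MemFlow B p (S p) := fun p hp hpγ' =>
    ⟨seqBox_of_le_pin (hS p hp (hpγ'.trans hγ'γ)).1 fun j =>
      (le_pin_of_memFlow hb hlo (hS p hp (hpγ'.trans hγ'γ)).1 (hS p hp (hpγ'.trans hγ'γ)).2 j).trans hpγ',
     (hS p hp (hpγ'.trans hγ'γ)).2⟩
  have hmono' : ∀ u v : ℕ → ℝ, SeqBox (h' N) u → SeqBox (h' N) v → (∀ i, u i ≤ v i) → B u ≤ B v :=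
    fun u v hu hv huv => hmono u v (seqBox_mono hγ'γ hu) (seqBox_mono hγ'γ hv) huv
  have hB'' : ∀ u u' : ℕ → ℝ, SeqBox (h' N) u → SeqBox (h' N) u' → ∀ D : ℝ, (∀ j, |u j - u' j| ≤ D) → |B u - B u'| ≤ M * D :=
    fun u u' hu hu' D hD => hB u u' (seqBox_mono hγ'γ hu) (seqBox_mono hγ'γ hu') D hD
  have hlo'' : ∀ u, SeqBox (h' N) u → b ≤ B u := fun u hu => hlo u (seqBox_mono hγ'γ hu)
  have huniq' : ∀ p, 0 < p → p ≤ h' N → ∀ u u' : ℕ → ℝ, SeqBox (h' N) u → SeqBox (h' N) u' →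
      MemFlow B p u → MemFlow B p u' → u = u' :=
    fun p hp hpγ' u u' hu hu' hfu hfu' => huniq p hp (hpγ'.trans hγ'γ) u u' (seqBox_mono hγ'γ hu) (seqBox_mono hγ'γ hu') hfu hfu'
  have hG'' : ∀ u, SeqBox (h' N) u → G (1 / u 0 ^ 2) ≤ B u := fun u hu => hG u (seqBox_mono hγ'γ hu)
  have hexc' : ∀ u, SeqBox (h' N) u → B u ≤ B' u := fun u hu => hexc u (seqBox_mono hγ'γ hu)
  have hbdd' : ∀ u, SeqBox (h' N) u → B' u ≤ βb := fun u hu => hbdd u (seqBox_mono hγ'γ hu)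
  have hDmono' : ∀ u v : ℕ → ℝ, SeqBox (h' N) u → SeqBox (h' N) v → (∀ i, u i ≤ v i) → B' u - B u ≤ B' v - B v :=
    fun u v hu hv huv => hDmono u v (seqBox_mono hγ'γ hu) (seqBox_mono hγ'γ hv) huv
  have hLip' : ∀ u v : ℕ → ℝ, SeqBox (h' N) u → SeqBox (h' N) v → (∀ k : ℕ, ψ^[k + 1] (1 / h' N ^ 2) ≤ 1 / u k ^ 2) →
      (∀ k : ℕ, ψ^[k + 1] (1 / h' N ^ 2) ≤ 1 / v k ^ 2) →
      B u - B v ≤ ∑ k ∈ range K, (fun k => Λ k (1 / h' N ^ 2)) k * max (1 / v k ^ 2 - 1 / u k ^ 2) 0 :=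
    fun u v hu hv hgu hgv => hLip (1 / h' N ^ 2) u v (seqBox_mono hγ'γ hu) (seqBox_mono hγ'γ hv) hgu hgv
  have hsw := (dual_steps_sandwich_gr (B := B) (B' := B') (γ := h' N) (S := S) (h' := fun i => h' (N + i)) hb hmono' hB'' hM hlo''
    hS' huniq' hG'' hψ hψmono (Λ := fun k => Λ k (1 / h' N ^ 2)) (fun k => hΛ k _) hθ hLip' hexc' hbdd' hDmono' hh'' hf'' m).1
  simpa [Nat.add_assoc] using hsw

end Summit.QuantumFields.BalabanUV.Beta.EriceRemainderEnclosureHistoryAutonomyComparisonMarkovGradingLinks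

end
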